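import Literature.NumberTheory.Automorphic.UnitaryGroupKernelClassOrbitalUnfolding
import Literature.NumberTheory.Automorphic.UnitaryGroupKernelClassEllipticFinite
import Literature.NumberTheory.Automorphic.UnitaryGroupEllipticCentralizerCompact
import Literature.NumberTheory.Automorphic.UnitaryGroupTruncatedKernelIntegrableCM
import Literature.NumberTheory.Automorphic.GLnIwasawaIntegration
import HarnessLib

/-!
# The elliptic terms of Arthur's coarse expansion for `U(J₃)` ARE orbital integrals — unconditionally

(Rogawski, *Automorphic Representations of Unitary Groups in Three Variables* (1990), §2.2–§2.3, pp. 13–14: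
for an elliptic class `𝔬`, `J_𝔬(f) = J^T_𝔬(f) = Σ_{γ ∈ 𝔬/∼} vol(G_γ(F)\G_γ(𝔸)) · Φ(γ, f)`; Arthur, *A trace
formula for reductive groups I*, Duke Math. J. 45 (1978), §8; Gelbart (1975), (9.13) and Thm. 9.22 (ii).)

Topic `NumberTheory/Automorphic`; namespace `Literature.NumberTheory.Automorphic.UnitaryGroup`. THEOREMS ONLY
(no definition, no named fact, no instance, no notation, no `sorry`). T1-qs LAW 4 «ELLIPTIC TERMS ARE ORBITAL
INTEGRALS» of the line `Cruxes/H413/Lines/F0_T1InnerFormTraceIdentity.lean` (cell `pub/hodgecm-mathlib`, crux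
H413) — THE TRUNK CLOSER (L4-d): the unfolding ★
`truncatedTraceClass_eq_mul_tsum_covol_mul_orbitalIntegral_of_forall_ne` ((L4-c-ii),
`UnitaryGroupKernelClassOrbitalUnfolding`) with BOTH geometric binders discharged for the quasi-split unitary
group in three variables — the cocompactness of the elliptic centralisers `G_γ(F)\G_γ(𝔸_F)` ((L4-b) ★
`compactSpace_centralizer_quotient_of_forall_cl_ne`, with the unimodularity of `G_γ(𝔸_F)` ★
`isMulRightInvariant_centralizer_of_forall_cl_ne`) and the finiteness `∫ Σ_{γ∈𝔬} |f(x γ x⁻¹)| dμ < ∞` ((L4-e) ★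
`lintegral_conjTsum_fiber_enorm_lt_top`) — so that for a test function `f`, an automorphic measure `μ`, ANY Haar
measure `ν` of `G(𝔸_F)` and ANY Haar measures `ν_s` of the centralisers, and every class `𝔬 = cl⁻¹{i}` of a
conjugation-invariant class map missing the rational Borel `B(F)`,

  `J^T_𝔬(f) = c_μ · Σ'_{s ⊆ 𝔬} vol(G_{γ_s}(F)\G_{γ_s}(𝔸_F)) · Φ_{ν/ν_s}(γ_s, f)`   for every `T`,

`c_μ = unfoldingConstant G(F) count μ ν` (Weil's constant of `μ`; `1` for `μ = ν/count`), the covolume taken for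
`ν_s` and the counting measure of `G_{γ_s}(F)`.

* `t2Space_quasiSplitAdelic`, `locallyCompactSpace_quasiSplitAdelic`, `secondCountableTopology_quasiSplitAdelic`,
  `isClosed_centralizer_quasiSplit`, `isClosed_inf_centralizer_subgroupOf_quasiSplit` — topological letters (public);
* `isInvInvariant_centralizer_of_forall_cl_ne` — Haar measures of elliptic centralisers are inversion invariant;
* `truncatedTraceClass_eq_mul_tsum_covol_mul_orbitalIntegral_of_isQuasiSplitTest` — generic quadratic `E/F`
  (`c² = 1`), `G(𝔸_F)` unimodular as an instance binder on `ν`;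
* **`truncatedTraceClass_eq_mul_tsum_covol_mul_orbitalIntegral_cm`** — the CM pair `(L⁺, L, complexConj)`:
  no hypothesis beyond the letters (`μ` automorphic, `ν`, `ν_s` Haar, `f` a test function, `𝔬 ∩ B(F) = ∅`).

## References
* J. D. Rogawski, *Automorphic Representations of Unitary Groups in Three Variables*, Ann. of Math. Stud.
  123 (1990), §2.2–§2.3 (pp. 13–14) [Rogawski1990].
* J. Arthur, *A trace formula for reductive groups I*, Duke Math. J. 45 (1978), §8 [Arthur1978TraceFormulaI].
* S. Gelbart, *Automorphic forms on adele groups*, Ann. of Math. Stud. 83 (1975), (9.13), Thm. 9.22 (ii),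
  Remark 9.23 [Gelbart1975].
-/

set_option autoImplicit false

noncomputable section

open MeasureTheory Measure NumberField IsDedekindDomain Set Topology
open Literature.MeasureTheory.Group
open scoped NNReal ENNReal Pointwise

namespace Literature.NumberTheory.Automorphic

namespace UnitaryGroup

variable {F E : Type} [Field F] [NumberField F] [Field E] [NumberField E] [Algebra F E]
  {c : E ≃ₐ[F] E} {N : ℕ} {ι : Type*}

/-! ## §1 Letters: the topology of `G(𝔸_F)`, closed centralisers, inversion invariance on elliptic centralisers -/

/-- `G(𝔸_F)` (`G = U(J_N)` quasi-split) is Hausdorff — the topology of ★ `UnitaryGroupOfFormAdelicTopology`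
on the datum's carrier (public letter; the tree's copies are private). [folklore] [cite: Rogawski1990, §2.2 (p. 13)] -/
theorem t2Space_quasiSplitAdelic : T2Space (quasiSplit F E c N).Adelic := by
  haveI := t2Space_adeleRing_of_numberField E
  exact inferInstanceAs (T2Space (adelic F E c N ((StdForm.antidiagonal N).over E)))

/-- `G(𝔸_F)` is locally compact. [folklore] [cite: Rogawski1990, §2.2 (p. 13)] -/
theorem locallyCompactSpace_quasiSplitAdelic : LocallyCompactSpace (quasiSplit F E c N).Adelic := by
  haveI := locallyCompactSpace_adeleRing' E
  exact inferInstanceAs (LocallyCompactSpace (adelic F E c N ((StdForm.antidiagonal N).over E)))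

/-- `G(𝔸_F)` is second countable. [folklore] [cite: Rogawski1990, §2.2 (p. 13)] -/
theorem secondCountableTopology_quasiSplitAdelic : SecondCountableTopology (quasiSplit F E c N).Adelic := by
  haveI := secondCountableTopology_adeleRing E
  exact inferInstanceAs (SecondCountableTopology (adelic F E c N ((StdForm.antidiagonal N).over E)))


/-- The centraliser `G_γ = C_{G(𝔸_F)}(γ)` of `γ ∈ G(𝔸_F)` (`G = U(J_N)` quasi-split) is closed
(`G(𝔸_F)` is Hausdorff). [folklore] [cite: Rogawski1990, §2.2 (p. 13)] -/
theorem isClosed_centralizer_quasiSplit (γ : (quasiSplit F E c N).Adelic) :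
    IsClosed ((Subgroup.centralizer ({γ} : Set (quasiSplit F E c N).Adelic) :
      Subgroup (quasiSplit F E c N).Adelic) : Set (quasiSplit F E c N).Adelic) := by
  haveI := t2Space_quasiSplitAdelic (F := F) (E := E) (c := c) (N := N)
  exact Set.isClosed_centralizer _

/-- `G(F)_γ = (A_G·G(F)) ∩ G_γ`, as a subgroup of the centraliser `G_γ`, is closed (`A_G·G(F) = G(F)` is closed,
★ `isClosed_quotientSubgroup_quasiSplit`) — the closedness letter of the covolume
`vol(G_γ(F)\G_γ(𝔸_F)) = quotientMeasure (G(F)_γ ≤ G_γ) count ν_γ (univ)`. [folklore] [cite: Rogawski1990, §2.2 (p. 13)] -/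
theorem isClosed_inf_centralizer_subgroupOf_quasiSplit (γ : (quasiSplit F E c N).Adelic) :
    IsClosed (((((quasiSplit F E c N).quotientSubgroup ⊓
        Subgroup.centralizer ({γ} : Set (quasiSplit F E c N).Adelic)).subgroupOf
        (Subgroup.centralizer ({γ} : Set (quasiSplit F E c N).Adelic))) :
        Subgroup ↥(Subgroup.centralizer ({γ} : Set (quasiSplit F E c N).Adelic))) :
      Set ↥(Subgroup.centralizer ({γ} : Set (quasiSplit F E c N).Adelic))) :=
  isClosed_subgroupOf _ _
    ((isClosed_quotientSubgroup_quasiSplit (F := F) (E := E) (c := c) (N := N)).inter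
      (isClosed_centralizer_quasiSplit γ))

section Measure

variable [MeasurableSpace (quasiSplit F E c 3).Adelic] [BorelSpace (quasiSplit F E c 3).Adelic]

/-- **Haar measures of elliptic centralisers are inversion invariant** (`G = U(J₃)` quasi-split, `c² = 1`): for a
conjugation-invariant class map `cl`, a class `i` missing `B(F)` and `γ` of class `i`, every Haar measure `ν_Z` of
`G_γ(𝔸_F)` satisfies `ν_Z(A⁻¹) = ν_Z(A)` — `G_γ(𝔸_F)` is unimodular (★ `isMulRightInvariant_centralizer_of_forall_cl_ne`,
reduction theory) and a two-sided Haar measure of a second countable locally compact group is inversion invariant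
(★ `isInvInvariant_of_isMulRightInvariant`). This is the last analytic binder of the Weil quotient `ν/ν_Z` carrying the
orbital integral at `γ`. [cite: Rogawski1990, §2.2 (p. 13)] -/
theorem isInvInvariant_centralizer_of_forall_cl_ne (hc : c * c = 1)
    {cl : (quasiSplit F E c 3).arithmeticSubgroup → ι} (hcl : IsConjInvariant cl) {i : ι}
    (hi : ∀ β : arithmeticBorel F E c 3, cl β ≠ i) {γ : (quasiSplit F E c 3).arithmeticSubgroup}
    (hγi : cl γ = i)
    (νZ : Measure ↥(Subgroup.centralizer ({(γ : (quasiSplit F E c 3).Adelic)} : Set (quasiSplit F E c 3).Adelic)))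
    [νZ.IsHaarMeasure] : νZ.IsInvInvariant := by
  haveI := t2Space_quasiSplitAdelic (F := F) (E := E) (c := c) (N := 3)
  haveI := locallyCompactSpace_quasiSplitAdelic (F := F) (E := E) (c := c) (N := 3)
  haveI := secondCountableTopology_quasiSplitAdelic (F := F) (E := E) (c := c) (N := 3)
  haveI : LocallyCompactSpace ↥(Subgroup.centralizer ({(γ : (quasiSplit F E c 3).Adelic)} :
      Set (quasiSplit F E c 3).Adelic)) :=
    (isClosed_centralizer_quasiSplit (γ : (quasiSplit F E c 3).Adelic)).isClosedEmbedding_subtypeVal.locallyCompactSpace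
  haveI : SecondCountableTopology ↥(Subgroup.centralizer ({(γ : (quasiSplit F E c 3).Adelic)} :
      Set (quasiSplit F E c 3).Adelic)) := TopologicalSpace.Subtype.secondCountableTopology _
  haveI := isMulRightInvariant_centralizer_of_forall_cl_ne hc hcl hi hγi νZ
  exact isInvInvariant_of_isMulRightInvariant νZ

/-! ## §2 The closer for a quadratic `E/F`: `J^T_𝔬(f) = c_μ · Σ_{s ⊆ 𝔬} covol_s · Φ_{ν/ν_s}(γ_s, f)` -/

/-- **THE ELLIPTIC TERMS ARE ORBITAL INTEGRALS — `U(J₃)` of a quadratic `E/F` (`c² = 1`), geometric binders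
discharged.** Let `cl` be a conjugation-invariant class map on `G(F)`, `i` a class with `cl β ≠ i` for all
`β ∈ B(F)`, `μ` an automorphic measure, `ν` a two-sided Haar measure of `G(𝔸_F)`, `rep` a section of the conjugacy
classes of `G(F)`, `ν_s` ANY Haar measures of the centralisers `G_{γ_s}(𝔸_F)` (`γ_s = rep s`, `s ⊆ 𝔬 = cl⁻¹{i}`),
`f` a test function. Then for every `ν₀`, `𝓕`, `T`: `[g] ↦ k^T_𝔬(g⁻¹, g⁻¹)` is `μ`-integrable and
`J^T_𝔬(f) = c_μ · Σ'_{s ⊆ 𝔬} vol(G_{γ_s}(F)\G_{γ_s}(𝔸_F)) · Φ_{ν/ν_s}(γ_s, f)`. The per-class compactness is (L4-b) ★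
`compactSpace_centralizer_quotient_of_forall_cl_ne`, the two-sidedness / inversion invariance of `ν_s` are ★
`isMulRightInvariant_centralizer_of_forall_cl_ne` / `isInvInvariant_centralizer_of_forall_cl_ne`, the finiteness is
(L4-e) ★ `lintegral_conjTsum_fiber_enorm_lt_top`, the counting Haar measures are (L4-c-ii) §2; all fed into ★
`truncatedTraceClass_eq_mul_tsum_covol_mul_orbitalIntegral_of_forall_ne`.
[cite: Rogawski1990, §2.2 (p. 13)] [cite: Arthur1978TraceFormulaI, §8] [cite: Gelbart1975, (9.13) and Thm. 9.22 (ii)] -/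
theorem truncatedTraceClass_eq_mul_tsum_covol_mul_orbitalIntegral_of_isQuasiSplitTest (hc : c * c = 1)
    [MeasurableSpace (adelicUnipotent F E c 3)]
    [∀ γ : (quasiSplit F E c 3).Adelic, MeasurableSpace ((quasiSplit F E c 3).Adelic ⧸
      Subgroup.centralizer ({γ} : Set (quasiSplit F E c 3).Adelic))]
    [∀ γ : (quasiSplit F E c 3).Adelic, BorelSpace ((quasiSplit F E c 3).Adelic ⧸
      Subgroup.centralizer ({γ} : Set (quasiSplit F E c 3).Adelic))]
    [∀ γ : (quasiSplit F E c 3).Adelic, MeasurableSpace (↥(Subgroup.centralizer ({γ} : Set (quasiSplit F E c 3).Adelic)) ⧸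
      ((quasiSplit F E c 3).quotientSubgroup ⊓ Subgroup.centralizer ({γ} : Set (quasiSplit F E c 3).Adelic)).subgroupOf
        (Subgroup.centralizer ({γ} : Set (quasiSplit F E c 3).Adelic)))]
    [∀ γ : (quasiSplit F E c 3).Adelic, BorelSpace (↥(Subgroup.centralizer ({γ} : Set (quasiSplit F E c 3).Adelic)) ⧸
      ((quasiSplit F E c 3).quotientSubgroup ⊓ Subgroup.centralizer ({γ} : Set (quasiSplit F E c 3).Adelic)).subgroupOf
        (Subgroup.centralizer ({γ} : Set (quasiSplit F E c 3).Adelic)))]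
    (μ : Measure (quasiSplit F E c 3).automorphicQuotient) [(quasiSplit F E c 3).IsAutomorphicMeasure μ]
    (ν : Measure (quasiSplit F E c 3).Adelic) [IsHaarMeasure ν] [ν.IsMulRightInvariant]
    {cl : (quasiSplit F E c 3).arithmeticSubgroup → ι} (hcl : IsConjInvariant cl) (i : ι)
    (rep : ConjClasses (quasiSplit F E c 3).arithmeticSubgroup → (quasiSplit F E c 3).arithmeticSubgroup)
    (hrep : ∀ s, ConjClasses.mk (rep s) = s)
    (νC : ∀ s : {s : ConjClasses (quasiSplit F E c 3).arithmeticSubgroup // cl (rep s) = i},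
      Measure ↥(Subgroup.centralizer ({((rep s.1 : (quasiSplit F E c 3).arithmeticSubgroup) : (quasiSplit F E c 3).Adelic)} :
        Set (quasiSplit F E c 3).Adelic)))
    [∀ s, IsHaarMeasure (νC s)]
    (hi : ∀ β : arithmeticBorel F E c 3, cl β ≠ i)
    {f : (quasiSplit F E c 3).Adelic → ℂ} (hf : IsQuasiSplitTest F E c 3 f)
    (ν₀ : Measure (adelicUnipotent F E c 3)) (𝓕 : Set (adelicUnipotent F E c 3)) (T : ℝ≥0) :
    haveI := t2Space_quasiSplitAdelic (F := F) (E := E) (c := c) (N := 3)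
    haveI := locallyCompactSpace_quasiSplitAdelic (F := F) (E := E) (c := c) (N := 3)
    haveI := secondCountableTopology_quasiSplitAdelic (F := F) (E := E) (c := c) (N := 3)
    haveI : IsClosed (((quasiSplit F E c 3).quotientSubgroup : Set (quasiSplit F E c 3).Adelic)) :=
      isClosed_quotientSubgroup_quasiSplit
    haveI : ∀ γ : (quasiSplit F E c 3).Adelic, IsClosed ((Subgroup.centralizer ({γ} : Set (quasiSplit F E c 3).Adelic) :
        Subgroup (quasiSplit F E c 3).Adelic) : Set (quasiSplit F E c 3).Adelic) := isClosed_centralizer_quasiSplit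
    haveI : ∀ γ : (quasiSplit F E c 3).Adelic, (count : Measure ↥(((quasiSplit F E c 3).quotientSubgroup ⊓
        Subgroup.centralizer ({γ} : Set (quasiSplit F E c 3).Adelic)).subgroupOf
          (Subgroup.centralizer ({γ} : Set (quasiSplit F E c 3).Adelic)))).IsHaarMeasure :=
      isHaarMeasure_count_inf_centralizer_subgroupOf_quasiSplit
    haveI : (count : Measure (quasiSplit F E c 3).quotientSubgroup).IsHaarMeasure :=
      isHaarMeasure_count_quotientSubgroup_quasiSplit
    haveI : ∀ s : {s : ConjClasses (quasiSplit F E c 3).arithmeticSubgroup // cl (rep s) = i},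
        (νC s).IsMulRightInvariant := fun s => isMulRightInvariant_centralizer_of_forall_cl_ne hc hcl hi s.2 (νC s)
    haveI : ∀ s : {s : ConjClasses (quasiSplit F E c 3).arithmeticSubgroup // cl (rep s) = i},
        (νC s).IsInvInvariant := fun s => isInvInvariant_centralizer_of_forall_cl_ne hc hcl hi s.2 (νC s)
    letI := AdelicGroupData.measurableSpaceQuotientForm (quasiSplit F E c 3)
    haveI := AdelicGroupData.borelSpaceQuotientForm (quasiSplit F E c 3)
    haveI := AdelicGroupData.smulInvariantMeasureQuotientForm (quasiSplit F E c 3) μ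
    haveI := AdelicGroupData.isFiniteMeasureOnCompactsQuotientForm (quasiSplit F E c 3) μ
    Integrable ((quasiSplit F E c 3).quotFun (truncatedKernelClass ν₀ 𝓕 T cl i f)) μ ∧
    truncatedTraceClass μ ν₀ 𝓕 T cl i f =
      ((unfoldingConstant (quasiSplit F E c 3).quotientSubgroup (count : Measure (quasiSplit F E c 3).quotientSubgroup) μ ν : ℝ) : ℂ) *
        ∑' s : {s : ConjClasses (quasiSplit F E c 3).arithmeticSubgroup // cl (rep s) = i},
          ((quotientMeasure (((quasiSplit F E c 3).quotientSubgroup ⊓ Subgroup.centralizer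
              ({((rep s.1 : (quasiSplit F E c 3).arithmeticSubgroup) : (quasiSplit F E c 3).Adelic)} : Set (quasiSplit F E c 3).Adelic)).subgroupOf
              (Subgroup.centralizer ({((rep s.1 : (quasiSplit F E c 3).arithmeticSubgroup) : (quasiSplit F E c 3).Adelic)} : Set (quasiSplit F E c 3).Adelic)))
              count (isClosed_inf_centralizer_subgroupOf_quasiSplit _) (νC s) Set.univ).toReal : ℂ) *
            orbitalIntegral ((rep s.1 : (quasiSplit F E c 3).arithmeticSubgroup) : (quasiSplit F E c 3).Adelic) f
              (quotientMeasure (Subgroup.centralizer ({((rep s.1 : (quasiSplit F E c 3).arithmeticSubgroup) :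
                (quasiSplit F E c 3).Adelic)} : Set (quasiSplit F E c 3).Adelic)) (νC s)
                (isClosed_centralizer_quasiSplit _) ν) := by
  -- topology of `G(𝔸_F)`
  haveI := t2Space_quasiSplitAdelic (F := F) (E := E) (c := c) (N := 3)
  haveI := locallyCompactSpace_quasiSplitAdelic (F := F) (E := E) (c := c) (N := 3)
  haveI := secondCountableTopology_quasiSplitAdelic (F := F) (E := E) (c := c) (N := 3)
  -- closedness letters and counting Haar measures ((L4-c-ii) §2)
  haveI hL : IsClosed (((quasiSplit F E c 3).quotientSubgroup : Set (quasiSplit F E c 3).Adelic)) :=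
    isClosed_quotientSubgroup_quasiSplit
  haveI hCcl : ∀ γ : (quasiSplit F E c 3).Adelic, IsClosed ((Subgroup.centralizer ({γ} : Set (quasiSplit F E c 3).Adelic) :
      Subgroup (quasiSplit F E c 3).Adelic) : Set (quasiSplit F E c 3).Adelic) := isClosed_centralizer_quasiSplit
  haveI : ∀ γ : (quasiSplit F E c 3).Adelic, (count : Measure ↥(((quasiSplit F E c 3).quotientSubgroup ⊓
      Subgroup.centralizer ({γ} : Set (quasiSplit F E c 3).Adelic)).subgroupOf
        (Subgroup.centralizer ({γ} : Set (quasiSplit F E c 3).Adelic)))).IsHaarMeasure :=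
    isHaarMeasure_count_inf_centralizer_subgroupOf_quasiSplit
  haveI : (count : Measure (quasiSplit F E c 3).quotientSubgroup).IsHaarMeasure :=
    isHaarMeasure_count_quotientSubgroup_quasiSplit
  -- the elliptic centralisers: unimodular, inversion invariant, cocompact ((L4-b))
  haveI : ∀ s : {s : ConjClasses (quasiSplit F E c 3).arithmeticSubgroup // cl (rep s) = i},
      (νC s).IsMulRightInvariant := fun s =>
    isMulRightInvariant_centralizer_of_forall_cl_ne hc hcl hi s.2 (νC s)
  haveI : ∀ s : {s : ConjClasses (quasiSplit F E c 3).arithmeticSubgroup // cl (rep s) = i},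
      (νC s).IsInvInvariant := fun s =>
    isInvInvariant_centralizer_of_forall_cl_ne hc hcl hi s.2 (νC s)
  haveI : ∀ s : {s : ConjClasses (quasiSplit F E c 3).arithmeticSubgroup // cl (rep s) = i},
      CompactSpace (↥(Subgroup.centralizer ({((rep s.1 : (quasiSplit F E c 3).arithmeticSubgroup) :
        (quasiSplit F E c 3).Adelic)} : Set (quasiSplit F E c 3).Adelic)) ⧸
        ((quasiSplit F E c 3).quotientSubgroup ⊓ Subgroup.centralizer ({((rep s.1 : (quasiSplit F E c 3).arithmeticSubgroup) :
          (quasiSplit F E c 3).Adelic)} : Set (quasiSplit F E c 3).Adelic)).subgroupOf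
          (Subgroup.centralizer ({((rep s.1 : (quasiSplit F E c 3).arithmeticSubgroup) : (quasiSplit F E c 3).Adelic)} :
            Set (quasiSplit F E c 3).Adelic))) := fun s =>
    compactSpace_centralizer_quotient_of_forall_cl_ne hc hcl hi s.2
  -- the finiteness ((L4-e)), for the finite automorphic measure `μ`
  letI := AdelicGroupData.measurableSpaceQuotientForm (quasiSplit F E c 3)
  haveI := AdelicGroupData.isFiniteMeasureQuotientForm (quasiSplit F E c 3) μ
  have hfin : ∫⁻ x, conjTsum (quasiSplit F E c 3).quotientSubgroup
      (((↑) : (quasiSplit F E c 3).arithmeticSubgroup → (quasiSplit F E c 3).Adelic) '' (cl ⁻¹' {i}))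
      (conj_mem_image_fiber hcl i) (fun g => (‖f g‖ₑ : ℝ≥0∞)) x ∂μ < ∞ :=
    lintegral_conjTsum_fiber_enorm_lt_top hc hcl (fun β hβ => hi ⟨β, hβ⟩) (conj_mem_image_fiber hcl i)
      hf.continuous' hf.hasCompactSupport' μ
  exact truncatedTraceClass_eq_mul_tsum_covol_mul_orbitalIntegral_of_forall_ne μ ν hcl i rep hrep νC hi
    hf.continuous'.measurable hfin ν₀ 𝓕 T

end Measure

/-! ## §3 The CM pair `(L⁺, L, complexConj)`: no hypothesis -/

/-- **THE ELLIPTIC TERMS OF THE COARSE GEOMETRIC EXPANSION FOR THE QUASI-SPLIT `U(J₃)` OF A CM FIELD ARE ORBITAL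
INTEGRALS** (Rogawski (1990), §2.3 p. 14; Arthur (1978), §8): for the CM pair `(L⁺, L, complexConj)`, a
conjugation-invariant class map `cl` on `G(L⁺)`, a class `i` with `cl β ≠ i` for every `β ∈ B(L⁺)`, an automorphic
measure `μ`, ANY Haar measure `ν` of `G(𝔸_{L⁺})` (two-sided: ★ `isMulRightInvariant_quasiSplit_cm_three`), a section
`rep` of the conjugacy classes, ANY Haar measures `ν_s` of the centralisers `G_{γ_s}(𝔸)` and a test function `f`:

  `J^T_𝔬(f) = c_μ · Σ'_{s ⊆ 𝔬} vol(G_{γ_s}(L⁺)\G_{γ_s}(𝔸_{L⁺})) · Φ_{ν/ν_s}(γ_s, f)`   for every `T`, `ν₀`, `𝓕`,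

with `c_μ = unfoldingConstant G(L⁺) count μ ν` and the covolume for `ν_s` and the counting measure — §2 at `c² = 1`
(★ `complexConj_mul_complexConj`). [cite: Rogawski1990, §2.2 (p. 13)] [cite: Arthur1978TraceFormulaI, §8]
[cite: Gelbart1975, (9.13) and Thm. 9.22 (ii)] -/
theorem truncatedTraceClass_eq_mul_tsum_covol_mul_orbitalIntegral_cm (L : Type) [Field L] [NumberField L] [IsCMField L]
    [MeasurableSpace (quasiSplit (↥(maximalRealSubfield L)) L (IsCMField.complexConj L) 3).Adelic]
    [BorelSpace (quasiSplit (↥(maximalRealSubfield L)) L (IsCMField.complexConj L) 3).Adelic]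
    [MeasurableSpace (adelicUnipotent (↥(maximalRealSubfield L)) L (IsCMField.complexConj L) 3)]
    [∀ γ : (quasiSplit (↥(maximalRealSubfield L)) L (IsCMField.complexConj L) 3).Adelic,
      MeasurableSpace ((quasiSplit (↥(maximalRealSubfield L)) L (IsCMField.complexConj L) 3).Adelic ⧸
        Subgroup.centralizer ({γ} : Set (quasiSplit (↥(maximalRealSubfield L)) L (IsCMField.complexConj L) 3).Adelic))]
    [∀ γ : (quasiSplit (↥(maximalRealSubfield L)) L (IsCMField.complexConj L) 3).Adelic,
      BorelSpace ((quasiSplit (↥(maximalRealSubfield L)) L (IsCMField.complexConj L) 3).Adelic ⧸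
        Subgroup.centralizer ({γ} : Set (quasiSplit (↥(maximalRealSubfield L)) L (IsCMField.complexConj L) 3).Adelic))]
    [∀ γ : (quasiSplit (↥(maximalRealSubfield L)) L (IsCMField.complexConj L) 3).Adelic,
      MeasurableSpace (↥(Subgroup.centralizer ({γ} : Set (quasiSplit (↥(maximalRealSubfield L)) L (IsCMField.complexConj L) 3).Adelic)) ⧸
        ((quasiSplit (↥(maximalRealSubfield L)) L (IsCMField.complexConj L) 3).quotientSubgroup ⊓
          Subgroup.centralizer ({γ} : Set (quasiSplit (↥(maximalRealSubfield L)) L (IsCMField.complexConj L) 3).Adelic)).subgroupOf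
          (Subgroup.centralizer ({γ} : Set (quasiSplit (↥(maximalRealSubfield L)) L (IsCMField.complexConj L) 3).Adelic)))]
    [∀ γ : (quasiSplit (↥(maximalRealSubfield L)) L (IsCMField.complexConj L) 3).Adelic,
      BorelSpace (↥(Subgroup.centralizer ({γ} : Set (quasiSplit (↥(maximalRealSubfield L)) L (IsCMField.complexConj L) 3).Adelic)) ⧸
        ((quasiSplit (↥(maximalRealSubfield L)) L (IsCMField.complexConj L) 3).quotientSubgroup ⊓
          Subgroup.centralizer ({γ} : Set (quasiSplit (↥(maximalRealSubfield L)) L (IsCMField.complexConj L) 3).Adelic)).subgroupOf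
          (Subgroup.centralizer ({γ} : Set (quasiSplit (↥(maximalRealSubfield L)) L (IsCMField.complexConj L) 3).Adelic)))]
    (μ : Measure (quasiSplit (↥(maximalRealSubfield L)) L (IsCMField.complexConj L) 3).automorphicQuotient)
    [(quasiSplit (↥(maximalRealSubfield L)) L (IsCMField.complexConj L) 3).IsAutomorphicMeasure μ]
    (ν : Measure (quasiSplit (↥(maximalRealSubfield L)) L (IsCMField.complexConj L) 3).Adelic) [IsHaarMeasure ν]
    {ι : Type*} {cl : (quasiSplit (↥(maximalRealSubfield L)) L (IsCMField.complexConj L) 3).arithmeticSubgroup → ι}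
    (hcl : IsConjInvariant cl) (i : ι)
    (rep : ConjClasses (quasiSplit (↥(maximalRealSubfield L)) L (IsCMField.complexConj L) 3).arithmeticSubgroup →
      (quasiSplit (↥(maximalRealSubfield L)) L (IsCMField.complexConj L) 3).arithmeticSubgroup)
    (hrep : ∀ s, ConjClasses.mk (rep s) = s)
    (νC : ∀ s : {s : ConjClasses (quasiSplit (↥(maximalRealSubfield L)) L (IsCMField.complexConj L) 3).arithmeticSubgroup // cl (rep s) = i},
      Measure ↥(Subgroup.centralizer ({((rep s.1 : (quasiSplit (↥(maximalRealSubfield L)) L (IsCMField.complexConj L) 3).arithmeticSubgroup) :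
        (quasiSplit (↥(maximalRealSubfield L)) L (IsCMField.complexConj L) 3).Adelic)} :
        Set (quasiSplit (↥(maximalRealSubfield L)) L (IsCMField.complexConj L) 3).Adelic)))
    [∀ s, IsHaarMeasure (νC s)]
    (hi : ∀ β : arithmeticBorel (↥(maximalRealSubfield L)) L (IsCMField.complexConj L) 3, cl β ≠ i)
    {f : (quasiSplit (↥(maximalRealSubfield L)) L (IsCMField.complexConj L) 3).Adelic → ℂ}
    (hf : IsQuasiSplitTest (↥(maximalRealSubfield L)) L (IsCMField.complexConj L) 3 f)
    (ν₀ : Measure (adelicUnipotent (↥(maximalRealSubfield L)) L (IsCMField.complexConj L) 3))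
    (𝓕 : Set (adelicUnipotent (↥(maximalRealSubfield L)) L (IsCMField.complexConj L) 3)) (T : ℝ≥0) :
    haveI := t2Space_quasiSplitAdelic (F := ↥(maximalRealSubfield L)) (E := L) (c := IsCMField.complexConj L) (N := 3)
    haveI := locallyCompactSpace_quasiSplitAdelic (F := ↥(maximalRealSubfield L)) (E := L) (c := IsCMField.complexConj L) (N := 3)
    haveI := secondCountableTopology_quasiSplitAdelic (F := ↥(maximalRealSubfield L)) (E := L) (c := IsCMField.complexConj L) (N := 3)
    haveI : IsClosed (((quasiSplit (↥(maximalRealSubfield L)) L (IsCMField.complexConj L) 3).quotientSubgroup : Set (quasiSplit (↥(maximalRealSubfield L)) L (IsCMField.complexConj L) 3).Adelic)) :=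
      isClosed_quotientSubgroup_quasiSplit
    haveI : ∀ γ : (quasiSplit (↥(maximalRealSubfield L)) L (IsCMField.complexConj L) 3).Adelic, IsClosed ((Subgroup.centralizer ({γ} : Set (quasiSplit (↥(maximalRealSubfield L)) L (IsCMField.complexConj L) 3).Adelic) :
        Subgroup (quasiSplit (↥(maximalRealSubfield L)) L (IsCMField.complexConj L) 3).Adelic) : Set (quasiSplit (↥(maximalRealSubfield L)) L (IsCMField.complexConj L) 3).Adelic) := isClosed_centralizer_quasiSplit
    haveI : ∀ γ : (quasiSplit (↥(maximalRealSubfield L)) L (IsCMField.complexConj L) 3).Adelic, (count : Measure ↥(((quasiSplit (↥(maximalRealSubfield L)) L (IsCMField.complexConj L) 3).quotientSubgroup ⊓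
        Subgroup.centralizer ({γ} : Set (quasiSplit (↥(maximalRealSubfield L)) L (IsCMField.complexConj L) 3).Adelic)).subgroupOf
          (Subgroup.centralizer ({γ} : Set (quasiSplit (↥(maximalRealSubfield L)) L (IsCMField.complexConj L) 3).Adelic)))).IsHaarMeasure :=
      isHaarMeasure_count_inf_centralizer_subgroupOf_quasiSplit
    haveI : (count : Measure (quasiSplit (↥(maximalRealSubfield L)) L (IsCMField.complexConj L) 3).quotientSubgroup).IsHaarMeasure :=
      isHaarMeasure_count_quotientSubgroup_quasiSplit
    haveI : ν.IsMulRightInvariant := isMulRightInvariant_quasiSplit_cm_three L ν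
    haveI : ∀ s : {s : ConjClasses (quasiSplit (↥(maximalRealSubfield L)) L (IsCMField.complexConj L) 3).arithmeticSubgroup // cl (rep s) = i},
        (νC s).IsMulRightInvariant := fun s =>
      isMulRightInvariant_centralizer_of_forall_cl_ne (complexConj_mul_complexConj L) hcl hi s.2 (νC s)
    haveI : ∀ s : {s : ConjClasses (quasiSplit (↥(maximalRealSubfield L)) L (IsCMField.complexConj L) 3).arithmeticSubgroup // cl (rep s) = i},
        (νC s).IsInvInvariant := fun s =>
      isInvInvariant_centralizer_of_forall_cl_ne (complexConj_mul_complexConj L) hcl hi s.2 (νC s)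
    letI := AdelicGroupData.measurableSpaceQuotientForm (quasiSplit (↥(maximalRealSubfield L)) L (IsCMField.complexConj L) 3)
    haveI := AdelicGroupData.borelSpaceQuotientForm (quasiSplit (↥(maximalRealSubfield L)) L (IsCMField.complexConj L) 3)
    haveI := AdelicGroupData.smulInvariantMeasureQuotientForm (quasiSplit (↥(maximalRealSubfield L)) L (IsCMField.complexConj L) 3) μ
    haveI := AdelicGroupData.isFiniteMeasureOnCompactsQuotientForm (quasiSplit (↥(maximalRealSubfield L)) L (IsCMField.complexConj L) 3) μ
    truncatedTraceClass μ ν₀ 𝓕 T cl i f =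
      ((unfoldingConstant (quasiSplit (↥(maximalRealSubfield L)) L (IsCMField.complexConj L) 3).quotientSubgroup
          (count : Measure (quasiSplit (↥(maximalRealSubfield L)) L (IsCMField.complexConj L) 3).quotientSubgroup) μ ν : ℝ) : ℂ) *
        ∑' s : {s : ConjClasses (quasiSplit (↥(maximalRealSubfield L)) L (IsCMField.complexConj L) 3).arithmeticSubgroup // cl (rep s) = i},
          ((quotientMeasure (((quasiSplit (↥(maximalRealSubfield L)) L (IsCMField.complexConj L) 3).quotientSubgroup ⊓
              Subgroup.centralizer ({((rep s.1 : (quasiSplit (↥(maximalRealSubfield L)) L (IsCMField.complexConj L) 3).arithmeticSubgroup) :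
                (quasiSplit (↥(maximalRealSubfield L)) L (IsCMField.complexConj L) 3).Adelic)} :
                Set (quasiSplit (↥(maximalRealSubfield L)) L (IsCMField.complexConj L) 3).Adelic)).subgroupOf
              (Subgroup.centralizer ({((rep s.1 : (quasiSplit (↥(maximalRealSubfield L)) L (IsCMField.complexConj L) 3).arithmeticSubgroup) :
                (quasiSplit (↥(maximalRealSubfield L)) L (IsCMField.complexConj L) 3).Adelic)} :
                Set (quasiSplit (↥(maximalRealSubfield L)) L (IsCMField.complexConj L) 3).Adelic)))
              count (isClosed_inf_centralizer_subgroupOf_quasiSplit _) (νC s) Set.univ).toReal : ℂ) *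
            orbitalIntegral ((rep s.1 : (quasiSplit (↥(maximalRealSubfield L)) L (IsCMField.complexConj L) 3).arithmeticSubgroup) :
                (quasiSplit (↥(maximalRealSubfield L)) L (IsCMField.complexConj L) 3).Adelic) f
              (quotientMeasure (Subgroup.centralizer ({((rep s.1 : (quasiSplit (↥(maximalRealSubfield L)) L (IsCMField.complexConj L) 3).arithmeticSubgroup) :
                (quasiSplit (↥(maximalRealSubfield L)) L (IsCMField.complexConj L) 3).Adelic)} :
                Set (quasiSplit (↥(maximalRealSubfield L)) L (IsCMField.complexConj L) 3).Adelic)) (νC s)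
                (isClosed_centralizer_quasiSplit _) ν) := by
  haveI : ν.IsMulRightInvariant := isMulRightInvariant_quasiSplit_cm_three L ν
  exact (truncatedTraceClass_eq_mul_tsum_covol_mul_orbitalIntegral_of_isQuasiSplitTest (complexConj_mul_complexConj L)
    μ ν hcl i rep hrep νC hi hf ν₀ 𝓕 T).2

end UnitaryGroup

end Literature.NumberTheory.Automorphic
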